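import Literature.NumberTheory.LFunctions.MoebiusWalshCircuitsACdProofs
import Literature.Computability.Complexity.MoebiusBoundedDepthWalshProofs
import HarnessLib

/-!
# Green 2012, Theorem 1 for `μ` (`Green2012_moebius_boundedDepth`), discharged

Topic `Literature/Computability/Complexity`; proofs-only sibling of `MoebiusBoundedDepth.lean`
(the named fact `Literature.Computability.Complexity.Green2012_moebius_boundedDepth`). Everything
here is PROVED (one theorem, no definition, no named fact).

B. Green, *On (not) computing the Möbius function using bounded depth circuits*, Combin. Probab.
Comput. **21** (2012) 942–951 (= arXiv:1103.4991) [Green2012], **Theorem 1** (p. 942; arXiv p. 1):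
"Suppose `N = 2ⁿ`. Let `F : {0,…,N-1} → {-1,1}` be an `AC⁰(d)` function. Then
`𝔼_{0 ≤ x ≤ N-1} μ(x)F(x) = O(e^{d log n - c n^{1/6d}})`, where `c > 0` is an absolute constant."

The printed proof is entirely in the tree, in the `LFunctions` vocabulary (`circuitCorrelation`,
`walshSum`), and this file only composes it and transports the result to this topic's rendering:

* §2 of the paper (Theorem 1 from Proposition 1: Parseval on the cube, the trivial bound on the
  low Walsh levels, Cauchy–Schwarz, and the Linial–Mansour–Nisan Fourier tails — in the tree in
  Tal's sharper form `Circuit.l1Level_acBasis_le`) is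
  `Literature.NumberTheory.LFunctions.green_moebius_ACd_of_fourierWalsh`
  (`LFunctions/MoebiusWalshCircuitsACdProofs.lean`);
* §§3–4 (Proposition 1 for `μ` from Kátai's Proposition 2, the minor-arc Proposition 4, the
  Harman–Kátai Lemma 1 and Corollary 2 of Theorem 3) is
  `Literature.Computability.Complexity.green_moebius_fourierWalsh_holds`
  (`MoebiusBoundedDepthWalshProofs.lean`), the discharge of the named fact
  `Literature.NumberTheory.LFunctions.green_moebius_fourierWalsh`;
* the proved dedup bridge `Literature.Computability.Complexity.Green2012_moebius_boundedDepth_iff`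
  (`MoebiusBoundedDepthProofs.lean`) identifies this topic's rendering (cube sum of
  `μ(val x) · sgn (K.eval x)`, all `n`, `sgn true = -1`) with
  `Literature.NumberTheory.LFunctions.green_moebius_ACd` (`circuitCorrelation`, `n ≥ 1`).

## References

* B. Green, Combin. Probab. Comput. 21 (2012) 942–951, Theorem 1; §2 (deduction from
  Proposition 1); §§3–4 (Proposition 1). [Green2012]
-/

namespace Literature.Computability.Complexity

/-- **Green 2012, Theorem 1 (Möbius is orthogonal to `AC⁰(d)` functions) — discharged.** The named
fact `Green2012_moebius_boundedDepth` holds: there are absolute `c > 0`, `C` such that for every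
`d ≥ 1`, every `n` and every circuit `K` over `acBasis` on `Fin n` with `K.depth ≤ d` and
`K.size ≤ n ^ d`, `|(∑ₓ μ(val x) · sgn (K.eval x)) / 2ⁿ| ≤ C · exp (d log n − c n^{1/(6d)})`.
Proof as printed: Theorem 1 from Proposition 1 (§2, `green_moebius_ACd_of_fourierWalsh`) applied
to the proved Proposition 1 (`green_moebius_fourierWalsh_holds`, §§3–4), transported along the
bridge `Green2012_moebius_boundedDepth_iff`. [cite: Green2012, Theorem 1] -/
theorem Green2012_moebius_boundedDepth_holds : Green2012_moebius_boundedDepth :=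
  Green2012_moebius_boundedDepth_iff.2
    (Literature.NumberTheory.LFunctions.green_moebius_ACd_of_fourierWalsh
      green_moebius_fourierWalsh_holds)

end Literature.Computability.Complexity
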